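import Mathlib
import Summits.KontsevichZagierPeriods.KontsevichZagierPeriods.Theorems.SoloInformedSumDatum
import Summits.KontsevichZagierPeriods.KontsevichZagierPeriods.Theorems.SoloInformedOrderCells
import HarnessLib
import HarnessLib.Audit

/-!
# SoloInformed — the garland chart of the depth-2 telescope step, every weight (PROGRAMME XXXIX, file 2)

Solo programme `solo-KontsevichZagierPeriods-informed`, session s46. Dimension `n = m + 4`.
The substitution `λ(x) = (x₀, x₀x₁, …, x₀⋯x_{m+2}, x_{m+3})` (prefix products on the first
`m + 3` coordinates, identity on the last) carries the left side `R₁` of the telescope step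
(`soloInformedSumDatum`) onto the GARLAND representation

  `G = [(0,1)ⁿ ∩ P_E, g]`,  `g(t) = ∏ᵢ ω_{εᵢ}(tᵢ) = 1/((t₀ ⋯ t_{m+1})(1 − t_{m+2})(1 − t_{m+3}))`,

where `P_E` is the order polytope of the garland poset `E` = the chain `t₀ > t₁ > ⋯ > t_{m+2}`
plus the pendant `t_{m+3} < t₀`, and `ε = (0, …, 0, 1, 1)`. Contents: the poset and its order set;
`λ`, its lower-triangular Jacobian `det J_λ = ∏_{i<m+3} ∏_{l<i} x_l = ∏_{j ≤ m+1} λ(x)_j`,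
injectivity, image; the pull-back identity; `G`; MOVE A `[R₁] − [G] ∈ relations` (rule (2)); and
the order-cell dissection of `G` into the pieces of the linear extensions of `E` (engine THM
XXXVIII, `soloInformed_of_sub_sum_linext`).

References: Kontsevich–Zagier 2001 §1.2 [KontsevichZagier2001]; S. Yamamoto, arXiv:1405.6499; R. Stanley 1986. -/

noncomputable section

open MeasureTheory Set MvPolynomial
open Literature.ModelTheory.ExponentialFields Literature.NumberTheory.Transcendental
open Literature.NumberTheory.Transcendental.KZ

namespace Summit.KontsevichZagierPeriods.KontsevichZagierPeriods.Theorems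

variable {m : ℕ}

/-! ## 1. The garland poset and its order polytope -/

/-- The garland poset in weight `m+4`: pairs `(a, b)` meaning `t_a < t_b` — the chain
`(j+1, j)` for `j ≤ m+1` and the pendant `(m+3, 0)`. -/
def soloInformedSumPoset (m : ℕ) : List (Fin (m + 4) × Fin (m + 4)) :=
  (List.finRange (m + 2)).map (fun j => (Fin.castSucc j.succ, Fin.castSucc (Fin.castSucc j))) ++
    [(Fin.last (m + 3), 0)]

/-- Membership in the garland order polytope. -/
theorem soloInformed_mem_sumOrderSet {t : Fin (m + 4) → ℝ} :
    t ∈ soloInformedOrderSet (soloInformedSumPoset m) ↔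
      (∀ j : Fin (m + 2), t (Fin.castSucc j.succ) < t (Fin.castSucc (Fin.castSucc j))) ∧
        t (Fin.last (m + 3)) < t 0 := by
  constructor
  · intro h
    exact ⟨fun j => h _ (List.mem_append_left _ (List.mem_map.2 ⟨j, List.mem_finRange j, rfl⟩)),
      h _ (List.mem_append_right _ (List.mem_singleton_self _))⟩
  · rintro ⟨h1, h2⟩ p hp
    rcases List.mem_append.1 hp with hp | hp
    · obtain ⟨j, -, rfl⟩ := List.mem_map.1 hp
      exact h1 j
    · rw [List.mem_singleton.1 hp]
      exact h2

/-- The chain condition in terms of values: `t_a < t_b` whenever `a = b + 1 ≤ m + 2`. -/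
theorem soloInformed_sumChain_iff {t : Fin (m + 4) → ℝ} :
    (∀ j : Fin (m + 2), t (Fin.castSucc j.succ) < t (Fin.castSucc (Fin.castSucc j))) ↔
      ∀ a b : Fin (m + 4), (a : ℕ) = b + 1 → (a : ℕ) ≤ m + 2 → t a < t b := by
  constructor
  · intro h a b hab ha
    have key := h ⟨b, by omega⟩
    have e1 : Fin.castSucc (Fin.succ (⟨b, by omega⟩ : Fin (m + 2))) = a := Fin.ext (by simp; omega)
    have e2 : Fin.castSucc (Fin.castSucc (⟨b, by omega⟩ : Fin (m + 2))) = b := Fin.ext (by simp)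
    rwa [e1, e2] at key
  · intro h j
    exact h _ _ (by simp) (by simp; omega)

/-- The garland domain `𝒢 = (0,1)ⁿ ∩ P_E`. -/
def soloInformedSumGarland (m : ℕ) : Set (Fin (m + 4) → ℝ) :=
  soloInformedOpenCube (m + 4) ∩ soloInformedOrderSet (soloInformedSumPoset m)

/-- An order polytope is `ℚ`-semialgebraic. -/
theorem soloInformed_isSemialgebraic_orderSet {n : ℕ} (E : List (Fin n × Fin n)) :
    IsSemialgebraic ℚ (soloInformedOrderSet E) := by
  have h : soloInformedOrderSet E = ⋂ p ∈ E.toFinset, {x : Fin n → ℝ | x p.1 < x p.2} := by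
    ext x; simp [soloInformedOrderSet]
  rw [h]
  exact IsSemialgebraic.biInter _ _ fun p _ => by
    simpa using isSemialgebraic_setOf_eval_lt (k := ℚ) (R := ℝ) (X p.1 : MvPolynomial (Fin n) ℚ) (X p.2)

/-- An order polytope is measurable. -/
theorem soloInformed_measurableSet_orderSet {n : ℕ} (E : List (Fin n × Fin n)) :
    MeasurableSet (soloInformedOrderSet E) := by
  have h : soloInformedOrderSet E = ⋂ p ∈ E.toFinset, {x : Fin n → ℝ | x p.1 < x p.2} := by
    ext x; simp [soloInformedOrderSet]
  rw [h]
  exact Finset.measurableSet_biInter _ fun p _ =>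
    measurableSet_lt (measurable_pi_apply _) (measurable_pi_apply _)

/-- `𝒢` is `ℚ`-semialgebraic. -/
theorem soloInformed_isSemialgebraic_sumGarland : IsSemialgebraic ℚ (soloInformedSumGarland m) :=
  (isSemialgebraic_soloInformedOpenCube _).inter (soloInformed_isSemialgebraic_orderSet _)

/-- `𝒢` is measurable. -/
theorem soloInformed_measurableSet_sumGarland : MeasurableSet (soloInformedSumGarland m) :=
  (soloInformed_measurableSet_openCube _).inter (soloInformed_measurableSet_orderSet _)

/-! ## 2. The garland integrand as a product of the forms `ω₀, ω₁` -/

/-- The letters of the garland integrand: `1` (form `dt/(1−t)`) exactly at `m+2` and `m+3`. -/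
def soloInformedSumEps (m : ℕ) (i : Fin (m + 4)) : Bool :=
  decide (i = Fin.castSucc (Fin.last (m + 2)) ∨ i = Fin.last (m + 3))

/-- The garland integrand `g(t) = ∏ᵢ ω_{εᵢ}(tᵢ)`. -/
def soloInformedSumG (t : Fin (m + 4) → ℝ) : ℝ := ∏ i, mzvForm (soloInformedSumEps m i) (t i)

/-- Auxiliary (sum chart): the letters at the three kinds of coordinates. -/
theorem soloInformedSumEps_cc (j : Fin (m + 2)) :
    soloInformedSumEps m (Fin.castSucc (Fin.castSucc j)) = false := by
  have h1 : Fin.castSucc (Fin.castSucc j) ≠ Fin.castSucc (Fin.last (m + 2)) := fun h =>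
    (Fin.castSucc_lt_last j).ne (Fin.castSucc_injective _ h)
  have h2 : Fin.castSucc (Fin.castSucc j) ≠ Fin.last (m + 3) := (Fin.castSucc_lt_last _).ne
  simp [soloInformedSumEps, h1, h2]

/-- Auxiliary (sum chart): `soloInformedSumEps_csLast`. -/
theorem soloInformedSumEps_csLast : soloInformedSumEps m (Fin.castSucc (Fin.last (m + 2))) = true := by
  simp [soloInformedSumEps]

/-- Auxiliary (sum chart): `soloInformedSumEps_last`. -/
theorem soloInformedSumEps_last : soloInformedSumEps m (Fin.last (m + 3)) = true := by
  simp [soloInformedSumEps]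

/-- **`g(t) = 1/((t₀ ⋯ t_{m+1})(1 − t_{m+2})(1 − t_{m+3}))`.** -/
theorem soloInformedSumG_eq (t : Fin (m + 4) → ℝ) : soloInformedSumG t =
    1 / ((∏ j : Fin (m + 2), t (Fin.castSucc (Fin.castSucc j))) *
      (1 - t (Fin.castSucc (Fin.last (m + 2)))) * (1 - t (Fin.last (m + 3)))) := by
  unfold soloInformedSumG
  rw [Fin.prod_univ_castSucc, Fin.prod_univ_castSucc]
  simp only [soloInformedSumEps_cc, soloInformedSumEps_csLast, soloInformedSumEps_last, mzvForm,
    if_true, Bool.false_eq_true, if_false, one_div]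
  rw [Finset.prod_inv_distrib, ← mul_inv, ← mul_inv]

/-- The denominator of `g` is positive on the cube. -/
theorem soloInformedSumG_den_pos {t : Fin (m + 4) → ℝ} (ht : t ∈ soloInformedOpenCube (m + 4)) :
    0 < (∏ j : Fin (m + 2), t (Fin.castSucc (Fin.castSucc j))) *
      (1 - t (Fin.castSucc (Fin.last (m + 2)))) * (1 - t (Fin.last (m + 3))) :=
  mul_pos (mul_pos (Finset.prod_pos fun j _ => (ht _).1) (by linarith [(ht (Fin.castSucc (Fin.last (m + 2)))).2]))
    (by linarith [(ht (Fin.last (m + 3))).2])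

/-! ## 3. The substitution `λ` -/

/-- The components of `λ`: prefix products, except the last which is `X_{m+3}`. -/
def soloInformedSumLamPoly (m : ℕ) (j : Fin (m + 4)) : MvPolynomial (Fin (m + 4)) ℚ :=
  if j = Fin.last (m + 3) then X (Fin.last (m + 3)) else soloInformedMonoPoly (m + 4) j

/-- `λ`. -/
def soloInformedSumLam (m : ℕ) : (Fin (m + 4) → ℝ) → Fin (m + 4) → ℝ :=
  soloInformedPolyMap (soloInformedSumLamPoly m)

/-- `λ(x)_j = x₀ ⋯ x_j` for `j ≠ m+3`. -/
theorem soloInformedSumLam_of_ne (x : Fin (m + 4) → ℝ) {j : Fin (m + 4)} (hj : j ≠ Fin.last (m + 3)) :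
    soloInformedSumLam m x j = soloInformedPrefixProd x j := by
  simp [soloInformedSumLam, soloInformedSumLamPoly, soloInformedPolyMap, hj, soloInformed_aeval_monoPoly]

/-- `λ(x)_{m+3} = x_{m+3}`. -/
@[simp] theorem soloInformedSumLam_last (x : Fin (m + 4) → ℝ) :
    soloInformedSumLam m x (Fin.last (m + 3)) = x (Fin.last (m + 3)) := by
  simp [soloInformedSumLam, soloInformedSumLamPoly, soloInformedPolyMap]

/-- `x₀ ⋯ x₀ = x₀`: the first prefix product. -/
theorem soloInformed_prefixProd_zero' {A : Type*} [CommMonoid A] (x : Fin (m + 4) → A) :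
    soloInformedPrefixProd x 0 = x 0 := by
  rw [soloInformedPrefixProd]
  have h : Finset.univ.filter (fun i : Fin (m + 4) => i ≤ 0) = {0} := by
    ext i
    simp only [Finset.mem_filter, Finset.mem_univ, true_and, Finset.mem_singleton]
    exact ⟨fun h => le_antisymm h (Fin.zero_le _), fun h => h.le⟩
  rw [h, Finset.prod_singleton]

/-- `x₀ ⋯ x_{m+2} = x₀ · (x₁ ⋯ x_{m+2})`. -/
theorem soloInformed_prefixProd_csLast (x : Fin (m + 4) → ℝ) :
    soloInformedPrefixProd x (Fin.castSucc (Fin.last (m + 2))) = soloInformedMidProd x * x 0 := by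
  have h : Finset.univ.filter (fun i : Fin (m + 4) => i ≤ Fin.castSucc (Fin.last (m + 2))) =
      insert 0 (soloInformedMid m) := by
    ext i
    simp only [Finset.mem_filter, Finset.mem_univ, true_and, Fin.le_def, Fin.val_castSucc,
      Fin.val_last, Finset.mem_insert, soloInformedMid, ne_eq, Fin.ext_iff, Fin.val_zero]
    omega
  rw [soloInformedPrefixProd, h, Finset.prod_insert soloInformed_zero_notMem_mid, mul_comm]
  rfl

/-- The last prefix product splits off `x_{m+3}`. -/
theorem soloInformed_prefixProd_last (x : Fin (m + 4) → ℝ) :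
    soloInformedPrefixProd x (Fin.last (m + 3)) =
      x (Fin.last (m + 3)) * soloInformedPrefixProd x (Fin.castSucc (Fin.last (m + 2))) := by
  have h := soloInformed_prefixProd_succ x (Fin.castSucc (Fin.last (m + 2))) (by simp)
  have e : (⟨(Fin.castSucc (Fin.last (m + 2)) : Fin (m + 4)).1 + 1, by simp⟩ : Fin (m + 4)) =
      Fin.last (m + 3) := Fin.ext (by simp)
  rw [e] at h
  exact h

/-- Prefix products at `j ≠ m+3` ignore the last coordinate. -/
theorem soloInformed_prefixProd_update_last {A : Type*} [CommMonoid A] (y : Fin (m + 4) → A) (v : A)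
    {j : Fin (m + 4)} (hj : j ≠ Fin.last (m + 3)) :
    soloInformedPrefixProd (Function.update y (Fin.last (m + 3)) v) j = soloInformedPrefixProd y j :=
  Finset.prod_congr rfl fun l hl => by
    rw [Function.update_of_ne]
    intro h
    have hle : l ≤ j := (Finset.mem_filter.1 hl).2
    rw [h] at hle
    exact hj (Fin.last_le_iff.1 hle)


/-- Above the diagonal the Jacobian matrix of `λ` vanishes. -/
theorem soloInformed_sumJacMat_of_lt {i j : Fin (m + 4)} (hij : i < j) :
    soloInformedJacMat (soloInformedSumLamPoly m) i j = 0 := by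
  rw [soloInformedJacMat_apply, soloInformedSumLamPoly]
  split_ifs with h
  · exact absurd (h ▸ hij) (not_lt.2 (Fin.le_last j))
  · have := soloInformed_jacPoly_kappa_of_lt (m := m + 4) hij
    rwa [soloInformedJacMat_apply] at this

/-- The diagonal of the Jacobian matrix of `λ`. -/
theorem soloInformed_sumJacMat_diag (i : Fin (m + 4)) :
    soloInformedJacMat (soloInformedSumLamPoly m) i i =
      if i = Fin.last (m + 3) then 1 else ∏ l ∈ Finset.univ.filter (fun l : Fin (m + 4) => l < i), X l := by
  rw [soloInformedJacMat_apply, soloInformedSumLamPoly]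
  split_ifs with h
  · subst h; exact pderiv_X_self _
  · have := soloInformed_jacPoly_kappa_diag (m := m + 4) i
    rwa [soloInformedJacMat_apply] at this

/-- **`det J_λ = ∏_{i ≤ m+2} ∏_{l<i} X_l`** (lower triangular). -/
theorem soloInformed_det_sumJacMat (m : ℕ) : (soloInformedJacMat (soloInformedSumLamPoly m)).det =
    ∏ i : Fin (m + 3), ∏ l ∈ Finset.univ.filter (fun l : Fin (m + 4) => l < Fin.castSucc i), X l := by
  rw [Matrix.det_of_lowerTriangular _ fun i j hij =>
    soloInformed_sumJacMat_of_lt (OrderDual.toDual_lt_toDual.1 hij), Fin.prod_univ_castSucc,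
    soloInformed_sumJacMat_diag, if_pos rfl, mul_one]
  exact Finset.prod_congr rfl fun i _ => by
    rw [soloInformed_sumJacMat_diag, if_neg (Fin.castSucc_lt_last i).ne]

/-- A double product of the variables below each index is a product of prefix products. -/
theorem soloInformed_prod_prod_lt_castSucc {A : Type*} [CommMonoid A] {k : ℕ} (x : Fin (k + 2) → A) :
    ∏ i : Fin (k + 1), ∏ l ∈ Finset.univ.filter (fun l : Fin (k + 2) => l < Fin.castSucc i), x l =
      ∏ j : Fin k, soloInformedPrefixProd x (Fin.castSucc (Fin.castSucc j)) := by
  rw [Fin.prod_univ_succ]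
  have h0 : Finset.univ.filter (fun l : Fin (k + 2) => l < Fin.castSucc (0 : Fin (k + 1))) = ∅ := by
    ext l; simp
  rw [h0, Finset.prod_empty, one_mul]
  refine Finset.prod_congr rfl fun j _ => ?_
  rw [soloInformedPrefixProd]
  congr 1
  ext l
  simp only [Finset.mem_filter, Finset.mem_univ, true_and, Fin.lt_def, Fin.le_def,
    Fin.val_castSucc, Fin.val_succ]
  omega

/-- **`det J_λ(x) = ∏_{j ≤ m+1} λ(x)_j`.** -/
theorem soloInformed_det_sumLam (x : Fin (m + 4) → ℝ) :
    (soloInformedJacCLM (soloInformedSumLamPoly m) x).det =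
      ∏ j : Fin (m + 2), soloInformedPrefixProd x (Fin.castSucc (Fin.castSucc j)) := by
  rw [soloInformed_det_jacCLM, soloInformed_det_sumJacMat]
  simp only [map_prod, aeval_X]
  exact soloInformed_prod_prod_lt_castSucc x

/-- The Jacobian determinant is positive on the cube. -/
theorem soloInformed_det_sumLam_pos {x : Fin (m + 4) → ℝ} (hx : x ∈ soloInformedOpenCube (m + 4)) :
    0 < (soloInformedJacCLM (soloInformedSumLamPoly m) x).det := by
  rw [soloInformed_det_sumLam]
  exact Finset.prod_pos fun j _ => soloInformed_prefixProd_pos hx _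


/-- `λ` is injective on the open cube. -/
theorem soloInformed_injOn_sumLam : InjOn (soloInformedSumLam m) (soloInformedOpenCube (m + 4)) := by
  intro x hx x' _ h
  have hl : x (Fin.last (m + 3)) = x' (Fin.last (m + 3)) := by
    simpa using congr_fun h (Fin.last (m + 3))
  refine soloInformed_prefixProd_injective (fun j => (hx j).1.ne') fun j => ?_
  by_cases hj : j = Fin.last (m + 3)
  · subst hj
    rw [soloInformed_prefixProd_last, soloInformed_prefixProd_last, hl,
      ← soloInformedSumLam_of_ne x (Fin.castSucc_lt_last _).ne,
      ← soloInformedSumLam_of_ne x' (Fin.castSucc_lt_last _).ne, h]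
  · rw [← soloInformedSumLam_of_ne x hj, ← soloInformedSumLam_of_ne x' hj, h]

/-- **`λ((0,1)ⁿ ∩ {x_{m+3} < x₀}) = 𝒢`.** -/
theorem soloInformed_image_sumLam : soloInformedSumLam m ''
    (soloInformedOpenCube (m + 4) ∩ {x | x (Fin.last (m + 3)) < x 0}) = soloInformedSumGarland m := by
  refine Subset.antisymm ?_ fun t ht => ?_
  · rintro _ ⟨x, ⟨hx, hl0⟩, rfl⟩
    have hl0' : x (Fin.last (m + 3)) < x 0 := hl0
    have hc := soloInformedOpenCube_subset_cube _ hx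
    refine ⟨fun j => ?_, soloInformed_mem_sumOrderSet.2 ⟨fun j => ?_, ?_⟩⟩
    · by_cases hj : j = Fin.last (m + 3)
      · subst hj; simpa using hx (Fin.last (m + 3))
      · rw [soloInformedSumLam_of_ne x hj]
        exact ⟨soloInformed_prefixProd_pos hx j,
          (soloInformed_prefixProd_le_apply hc j).trans_lt (hx j).2⟩
    · rw [soloInformedSumLam_of_ne x (Fin.castSucc_lt_last _).ne,
        soloInformedSumLam_of_ne x (Fin.castSucc_lt_last _).ne]
      exact soloInformed_prefixProd_strictAnti hx (Fin.lt_def.2 (by simp))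
    · rw [soloInformedSumLam_last, soloInformedSumLam_of_ne x (soloInformed_fin_ne (m := m)).2.2.1,
        soloInformed_prefixProd_zero']
      exact hl0'
  · have hcube := ht.1
    have hord := soloInformed_mem_sumOrderSet.1 ht.2
    have hchain := soloInformed_sumChain_iff.1 hord.1
    have hne : ∀ j, t j ≠ 0 := fun j => (hcube j).1.ne'
    set x : Fin (m + 4) → ℝ :=
      Function.update (soloInformedPrefixInv t) (Fin.last (m + 3)) (t (Fin.last (m + 3))) with hxdef
    have hlam : soloInformedSumLam m x = t := by
      funext j
      by_cases hj : j = Fin.last (m + 3)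
      · subst hj; simp [hxdef]
      · rw [soloInformedSumLam_of_ne x hj, hxdef, soloInformed_prefixProd_update_last _ _ hj,
          soloInformed_prefixProd_prefixInv t hne]
    refine ⟨x, ⟨fun j => ?_, ?_⟩, hlam⟩
    · by_cases hj : j = Fin.last (m + 3)
      · subst hj; simpa [hxdef] using hcube (Fin.last (m + 3))
      · rw [hxdef, Function.update_of_ne hj, soloInformedPrefixInv]
        split_ifs with h0
        · exact hcube j
        · have hlt : t j < t ⟨j.1 - 1, by omega⟩ :=
            hchain j ⟨j.1 - 1, by omega⟩ (by simp; omega) (by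
              have := Fin.val_lt_last hj; simp at this ⊢; omega)
          exact ⟨div_pos (hcube j).1 (hcube _).1, (div_lt_one (hcube _).1).2 hlt⟩
    · show x (Fin.last (m + 3)) < x 0
      have hx0 : x 0 = t 0 := by
        rw [hxdef, Function.update_of_ne (soloInformed_fin_ne (m := m)).2.2.1, soloInformedPrefixInv]
        simp
      rw [hx0, hxdef, Function.update_self]
      exact hord.2

/-! ## 4. The garland representation and MOVE A -/

/-- **The pull-back identity** `R₁(x) = g(λ x) · |det J_λ(x)|` on the cube. -/
theorem soloInformed_sumG_lam {x : Fin (m + 4) → ℝ} (hx : x ∈ soloInformedOpenCube (m + 4)) :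
    1 / ((1 - soloInformedMidProd x * x 0) * (1 - x (Fin.last (m + 3)))) =
      soloInformedSumG (soloInformedSumLam m x) * |(soloInformedJacCLM (soloInformedSumLamPoly m) x).det| := by
  have hD := soloInformed_det_sumLam_pos hx
  rw [abs_of_pos hD, soloInformed_det_sumLam, soloInformedSumG_eq]
  simp only [soloInformedSumLam_last, soloInformedSumLam_of_ne x (Fin.castSucc_lt_last _).ne,
    soloInformed_prefixProd_csLast]
  have hDne : (∏ j : Fin (m + 2), soloInformedPrefixProd x (Fin.castSucc (Fin.castSucc j))) ≠ 0 := by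
    rw [← soloInformed_det_sumLam]; exact hD.ne'
  have h1 : (1 - soloInformedMidProd x * x 0) ≠ 0 := (soloInformed_sum_one_sub_pos hx).ne'
  have h2 : (1 - x (Fin.last (m + 3))) ≠ 0 := by linarith [(hx (Fin.last (m + 3))).2]
  field_simp

/-- Integrability of `g` on `𝒢` (transport of `R₁` along `λ`). -/
theorem soloInformed_integrableOn_sumG : IntegrableOn soloInformedSumG (soloInformedSumGarland m) := by
  rw [← soloInformed_image_sumLam, soloInformedSumLam, soloInformed_integrableOn_image_polyMap_iff _
    soloInformed_measurableSet_sumD1 (soloInformed_injOn_sumLam.mono inter_subset_left)]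
  have h := (soloInformedSumDatum m).R1.integrableOn
  rw [soloInformedSum_R1_domain] at h
  refine h.congr_fun (fun x hx => ?_) soloInformed_measurableSet_sumD1
  rw [soloInformedSum_R1_integrand, soloInformed_sumG_lam hx.1, mul_comm]
  rfl

/-- **The garland representation `G = [𝒢, g]`.** -/
def soloInformedSumGRep (m : ℕ) : IntegralRep (m + 4) where
  domain := soloInformedSumGarland m
  integrand := soloInformedSumG
  isSemialgebraic_domain := soloInformed_isSemialgebraic_sumGarland
  isSemialgebraicFunOn_integrand :=
    soloInformed_isSemialgebraicFunOn_quot soloInformed_isSemialgebraic_sumGarland 1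
      ((∏ j : Fin (m + 2), X (Fin.castSucc (Fin.castSucc j))) *
        (1 - X (Fin.castSucc (Fin.last (m + 2)))) * (1 - X (Fin.last (m + 3)))) _
      (fun t ht => by simpa [map_prod] using (soloInformedSumG_den_pos ht.1).ne')
      fun t _ => by rw [soloInformedSumG_eq]; simp [map_prod]
  integrableOn := soloInformed_integrableOn_sumG

/-- Auxiliary (sum chart): `soloInformedSumGRep_domain`. -/
@[simp] theorem soloInformedSumGRep_domain : (soloInformedSumGRep m).domain = soloInformedSumGarland m := rfl

/-- Auxiliary (sum chart): `soloInformedSumGRep_integrand`. -/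
@[simp] theorem soloInformedSumGRep_integrand : (soloInformedSumGRep m).integrand = soloInformedSumG := rfl

/-- **MOVE A (rule (2) along `λ`)**: `[R₁] − [G] ∈ relations`. -/
theorem soloInformed_sum_moveA :
    of (soloInformedSumDatum m).R1 - of (soloInformedSumGRep m) ∈ relations := by
  refine soloInformed_of_sub_of_mem_relations_polyMapCLM (soloInformedSumLamPoly m)
    (soloInformedSumDatum m).R1 (soloInformedSumGRep m) ?_ ?_ fun x hx => ?_
  · rw [soloInformedSum_R1_domain]; exact soloInformed_injOn_sumLam.mono inter_subset_left
  · rw [soloInformedSum_R1_domain]; exact soloInformed_image_sumLam.symm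
  · rw [soloInformedSum_R1_domain] at hx
    rw [soloInformedSum_R1_integrand]
    exact soloInformed_sumG_lam hx.1

/-! ## 5. The order-cell dissection of `G` (engine THM XXXVIII) -/

/-- **`[G] − ∑_{σ ⊨ E} [G|_{C_σ}] ∈ relations`**, the sum over the linear extensions of the
garland poset. -/
theorem soloInformed_sumG_dissect :
    of (soloInformedSumGRep m) - ∑ σ ∈ Finset.univ.filter (soloInformedCompat (soloInformedSumPoset m)),
      of (soloInformedCellRep (soloInformedSumGRep m) σ) ∈ relations :=
  soloInformed_of_sub_sum_linext _ (soloInformedSumPoset m) inter_subset_right _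
    fun _ hσ => Finset.mem_filter.2 ⟨Finset.mem_univ _, hσ⟩

end Summit.KontsevichZagierPeriods.KontsevichZagierPeriods.Theorems
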